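import Summits.CriticalPhenomena.PercolationContinuityZ3.Theorems.PercNearOneGluingNoHeavyPcintRungEightBrackets
import Summits.CriticalPhenomena.PercolationContinuityZ3.Theorems.PercNearOneGluingNoHeavyPcintLoopExclusionBondRungFour
import HarnessLib

/-!
# CriticalPhenomena/PercolationContinuityZ3 — Theorems/PercNearOneGluingNoHeavyPcintLoopExclusionRungEightDimension.lean: the THIRD-RUNG DIMENSION LAW of C4 — `0 < R_8(d) < 1` and `R_8(d) < R_6(d)` for every `d ≥ 2`, `R_8(d) < R_8(d+1)` for every `d ≥ 2`, and `2d·(1 − R_8(d)) → 70/27`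

Lane prim-pcint, STRUCTURE rule (prim-pcint-2 GEN 18; P19 pre-registered 04:46Z, all structural items HIT).  Inputs: `μ_8(ℤ^d)` to order
`σ⁻⁷` for all `d ≥ 5` (…MemUniformEight: the 289-class memory-8 automaton is uniform in `d` from base dimension 5), `μ_6(ℤ^d)` likewise
(…MemUniformSix), seven-term brackets of `μ_4` (…MemoryFourBracketsSeven), the exact polygon counts `2·6·p_6(ℤ^d) = 4d(d−1)(8d−13)`
(…ClosingHexagonsExact) and `2·8·p_8(ℤ^d) = 8d(d−1)(54d²−208d+207)` (…ClosingOctagonsExactAll, `d ≥ 5`; `ℤ⁴`: …ClosingOctagonsZ4Exact),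
and the kernel cells `d = 2, 3, 4` (…LoopExclusionTable).  Method: `loopCompat_le_of_brackets` / `loopCompat_ge_of_brackets` turn
brackets of the two growth constants and the exact count into bounds `(U/L' − 1)U^τ/C` and `(1 − U'/L)L^τ/C` for `R_τ = Δ_τ/f_τ`; with
polynomial brackets these are ratios of INTEGER POLYNOMIALS in `d` (`rup_identity`, `rlo_identity`; degrees ≤ 76), and every comparison
below is ONE coefficient-list certificate of …PcintPolyCert decided by the kernel (no `ring` on large polynomials).  Results:

* **`loopCompatWindow_rung_eight`**: `0 < R_8(d) < 1` for every `d ≥ 2` (clause (a) at `m = 4`);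
* **`loopCompat_eight_lt_six`** (`∀ d ≥ 2`), **`loopCompatStrictAntiMemory_rung_three`**: `R_8(d) < R_6(d)` — clause (c) at `m = 3`
  in every dimension (`d ≥ 7` symbolic, `d = 5, 6` numeral certificates, `d ≤ 4` kernel cells);
* **`loopCompat_eight_lt_succ`** (`∀ d ≥ 2`), **`loopCompatStrictMonoDim_rung_eight`**: `R_8(d) < R_8(d+1)` — clause (b) at `m = 4` in
  every dimension (`d ≥ 7` symbolic; `(5,6), (6,7)` numeral; `4 → 5` and `3 → 4` from the `ℤ⁴` cells incl. the exact octagon count `22944`;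
  `2 → 3` from …RungTenZ2);
* **`sigma_one_sub_loopCompat_eight_ge` / `_le`**: `70/27 − 4/d ≤ 2d·(1 − R_8(d)) ≤ 70/27 + 4/d` for every `d ≥ 5`, hence
  **`tendsto_sigma_mul_one_sub_loopCompat_eight`**: `2d(1 − R_8(d)) → 70/27` — the THIRD mean-field constant is `c_4 = 70/27`
  (P19d: predicted `∈ [2.55, 2.63]`; exact series `R_8 = 1 − (70/27)/σ − (1735/729)/σ² − …`); `loopCompatMeanField_rung_eight`,
  `tendsto_loopCompat_eight` (`R_8(d) → 1`), `loopCompatTendstoOne_rung_eight`.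
So C4's clauses (a), (b) hold at `m ≤ 4`, (c) at `m ≤ 3`, in every dimension, and `c_2 = 2`, `c_3 = 5/2`, `c_4 = 70/27` are theorems.

HONEST FRAMING: bracket arithmetic on the uniform certificates; nothing here is used by a certified `p_c` cell.  No `sorry`; standard
axioms.  Generated by numerics/gen_u8law.py of the seat folder.  Written by prim-pcint-2 gen 18 (prover-prim-pcint-2-g18-0), 2026-08-26.
-/

noncomputable section

open Filter Topology
open Literature.Probability.LatticeModels Literature.Probability.Percolation
open Summit.CriticalPhenomena.PercolationContinuityZ3.Theorems.Pcint
open Summit.CriticalPhenomena.PercolationContinuityZ3.Theorems.Pcint.PolyCert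

namespace Summit.CriticalPhenomena.PercolationContinuityZ3.Theorems.Pcint.MemoryTail

variable {d : ℕ}

/-! ### Clause (a) at the third rung: `0 < R_8(d) < 1` in every dimension -/

/-- `R_8(d) < 1` for `d ≥ 5` (certificate `NU8 < DE8` on `[5, ∞)`). [folklore] -/
theorem loopCompat_eight_lt_one_of_five_le (hd : 5 ≤ d) : loopCompat d 8 < 1 := by
  have hlt : peval NU8 d < peval DE8 d := peval_lt_of_shift (c := 5) (by decide +kernel) (by exact_mod_cast hd)
  have h := loopCompat_eight_le_peval hd
  exact lt_of_le_of_lt h ((div_lt_one (DE8_pos hd)).2 hlt)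

/-- `0 < R_8(d)` for `d ≥ 5` (certificate `NL8 > 0` on `[5, ∞)`; i.e. `μ_8 < μ_6` in every dimension `d ≥ 5`). [folklore] -/
theorem loopCompat_eight_pos_of_five_le (hd : 5 ≤ d) : 0 < loopCompat d 8 := by
  have hN : 0 < peval NL8 d := peval_pos_of_shift (c := 5) (by decide +kernel) (by exact_mod_cast hd)
  exact lt_of_lt_of_le (div_pos hN (DL8_pos hd)) (loopCompat_eight_ge_peval hd)

/-- **`R_8(d) < 1` for every `d ≥ 2`.** [folklore] -/
theorem loopCompat_eight_lt_one (hd : 2 ≤ d) : loopCompat d 8 < 1 := by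
  rcases Nat.lt_or_ge d 5 with h | h
  · interval_cases d
    · exact loopCompatWindow_two.2.2
    · exact loopCompatWindow_three_four.2
    · exact loopCompatWindow_four_four.2
  · exact loopCompat_eight_lt_one_of_five_le h

/-- **`0 < R_8(d)` for every `d ≥ 2`.** [folklore] -/
theorem loopCompat_eight_pos (hd : 2 ≤ d) : 0 < loopCompat d 8 := by
  rcases Nat.lt_or_ge d 5 with h | h
  · interval_cases d
    · exact loopCompatWindow_two.2.1
    · exact loopCompatWindow_three_four.1
    · exact loopCompatWindow_four_four.1
  · exact loopCompat_eight_pos_of_five_le h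

/-- **Clause (a) of C4 (`loopCompatWindow`) at the third rung, every dimension**: `0 < R_8(d) < 1` for all `d ≥ 2`. [folklore] -/
theorem loopCompatWindow_rung_eight (d : ℕ) (hd : 2 ≤ d) : 0 < loopCompat d (2 * 4) ∧ loopCompat d (2 * 4) < 1 :=
  ⟨loopCompat_eight_pos hd, loopCompat_eight_lt_one hd⟩

/-! ### Clause (c) at `m = 3`: `R_8(d) < R_6(d)` in every dimension -/

/-- `R_8(d) < R_6(d)` for `d ≥ 7` (certificate `NU8·DL6 < NL6·DE8` on `[7, ∞)`). [folklore] -/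
theorem loopCompat_eight_lt_six_of_seven_le (hd : 7 ≤ d) : loopCompat d 8 < loopCompat d 6 := by
  have h8 := loopCompat_eight_le_peval (d := d) (by omega)
  have h6 := loopCompat_six_ge_peval (d := d) (by omega)
  have hlt : peval (pmul NU8 DL6) d < peval (pmul NL6 DE8) d :=
    peval_lt_of_shift (c := 7) (by decide +kernel) (by exact_mod_cast hd)
  rw [peval_pmul, peval_pmul] at hlt
  refine lt_of_le_of_lt h8 (lt_of_lt_of_le ?_ h6)
  rw [div_lt_div_iff₀ (DE8_pos (by omega)) (DL6_pos (by omega))]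
  linarith
/-- Numeral upper bound of `R_8(ℤ⁵)` (`μ_6 ≤ 88815568/10⁷`, `μ_8 ≥ 88678853/10⁷`, `2·8·p_8 = 82720`). [folklore] -/
theorem loopCompat_eight_zd5_le_num :
    loopCompat 5 8 ≤ (((88815568 : ℝ) / 10000000) / ((88678853 : ℝ) / 10000000) - 1) * ((88815568 : ℝ) / 10000000) ^ 8 / 82720 := by
  have hc : ((closingCount 5 8 : ℕ) : ℝ) = 82720 := by rw [closingCount_eight_eq (by norm_num)]; norm_num
  exact loopCompat_le_of_brackets (d := 5) (τ := 8) memGrowth_six_zd5_bounds.2 memGrowth_eight_zd5_bounds.1 (by norm_num) hc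
    (by norm_num)

/-- Numeral lower bound of `R_8(ℤ⁵)` (`μ_6 ≥ 88815512/10⁷`, `μ_8 ≤ 88678909/10⁷`). [folklore] -/
theorem loopCompat_eight_zd5_ge_num :
    (1 - ((88678909 : ℝ) / 10000000) / ((88815512 : ℝ) / 10000000)) * ((88815512 : ℝ) / 10000000) ^ 8 / 82720 ≤ loopCompat 5 8 := by
  have hc : ((closingCount 5 8 : ℕ) : ℝ) = 82720 := by rw [closingCount_eight_eq (by norm_num)]; norm_num
  exact loopCompat_ge_of_brackets (d := 5) (τ := 8) memGrowth_six_zd5_bounds.1 (by norm_num) memGrowth_eight_zd5_bounds.2 hc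
    (by norm_num)
/-- Numeral lower bound of `R_6(ℤ⁵)` (seven-term `μ_4` lower bracket at `x = 9`, `μ_6 ≤ 88815568/10⁷`, `2·6·p_6 = 2160`). [folklore] -/
theorem loopCompat_six_zd5_ge_num :
    (1 - ((88815568 : ℝ) / 10000000) / ((526147 : ℝ) / 59049)) * ((526147 : ℝ) / 59049) ^ 6 / 2160 ≤ loopCompat 5 6 := by
  have hc : ((closingCount 5 6 : ℕ) : ℝ) = 2160 := by rw [closingCount_six_eq (by norm_num)]; norm_num
  have h4 : ((526147 : ℝ) / 59049) ≤ memGrowth 5 4 := by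
    have h := memGrowth_four_ge_series7 (d := 5) (by norm_num) (x := 9) (by norm_num)
    norm_num at h ⊢
    linarith
  exact loopCompat_ge_of_brackets (d := 5) (τ := 6) h4 (by norm_num) memGrowth_six_zd5_bounds.2 hc (by norm_num)

/-- `R_8(ℤ⁵) < R_6(ℤ⁵)` (numeral certificates; `0.7216 < 0.7486`). [folklore] -/
theorem loopCompat_eight_lt_six_zd5 : loopCompat 5 8 < loopCompat 5 6 := by
  have h1 := loopCompat_eight_zd5_le_num
  have h2 := loopCompat_six_zd5_ge_num
  have hq1 : (((88815568 : ℝ) / 10000000) / ((88678853 : ℝ) / 10000000) - 1) * ((88815568 : ℝ) / 10000000) ^ 8 / 82720 < ((147 : ℝ) / 200) := by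
    norm_num
  have hq2 : ((147 : ℝ) / 200) < (1 - ((88815568 : ℝ) / 10000000) / ((526147 : ℝ) / 59049)) * ((526147 : ℝ) / 59049) ^ 6 / 2160 := by
    norm_num
  linarith
/-- Numeral upper bound of `R_8(ℤ⁶)` (`μ_6 ≤ 109024394/10⁷`, `μ_8 ≥ 108933291/10⁷`, `2·8·p_8 = 216720`). [folklore] -/
theorem loopCompat_eight_zd6_le_num :
    loopCompat 6 8 ≤ (((109024394 : ℝ) / 10000000) / ((108933291 : ℝ) / 10000000) - 1) * ((109024394 : ℝ) / 10000000) ^ 8 / 216720 := by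
  have hc : ((closingCount 6 8 : ℕ) : ℝ) = 216720 := by rw [closingCount_eight_eq (by norm_num)]; norm_num
  exact loopCompat_le_of_brackets (d := 6) (τ := 8) memGrowth_six_zd6_bounds.2 memGrowth_eight_zd6_bounds.1 (by norm_num) hc
    (by norm_num)

/-- Numeral lower bound of `R_8(ℤ⁶)` (`μ_6 ≥ 109024326/10⁷`, `μ_8 ≤ 108933359/10⁷`). [folklore] -/
theorem loopCompat_eight_zd6_ge_num :
    (1 - ((108933359 : ℝ) / 10000000) / ((109024326 : ℝ) / 10000000)) * ((109024326 : ℝ) / 10000000) ^ 8 / 216720 ≤ loopCompat 6 8 := by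
  have hc : ((closingCount 6 8 : ℕ) : ℝ) = 216720 := by rw [closingCount_eight_eq (by norm_num)]; norm_num
  exact loopCompat_ge_of_brackets (d := 6) (τ := 8) memGrowth_six_zd6_bounds.1 (by norm_num) memGrowth_eight_zd6_bounds.2 hc
    (by norm_num)
/-- Numeral lower bound of `R_6(ℤ⁶)` (seven-term `μ_4` lower bracket at `x = 11`, `μ_6 ≤ 109024394/10⁷`, `2·6·p_6 = 4200`). [folklore] -/
theorem loopCompat_six_zd6_ge_num :
    (1 - ((109024394 : ℝ) / 10000000) / ((1759287 : ℝ) / 161051)) * ((1759287 : ℝ) / 161051) ^ 6 / 4200 ≤ loopCompat 6 6 := by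
  have hc : ((closingCount 6 6 : ℕ) : ℝ) = 4200 := by rw [closingCount_six_eq (by norm_num)]; norm_num
  have h4 : ((1759287 : ℝ) / 161051) ≤ memGrowth 6 4 := by
    have h := memGrowth_four_ge_series7 (d := 6) (by norm_num) (x := 11) (by norm_num)
    norm_num at h ⊢
    linarith
  exact loopCompat_ge_of_brackets (d := 6) (τ := 6) h4 (by norm_num) memGrowth_six_zd6_bounds.2 hc (by norm_num)

/-- `R_8(ℤ⁶) < R_6(ℤ⁶)` (numeral certificates; `0.7703 < 0.7907`). [folklore] -/
theorem loopCompat_eight_lt_six_zd6 : loopCompat 6 8 < loopCompat 6 6 := by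
  have h1 := loopCompat_eight_zd6_le_num
  have h2 := loopCompat_six_zd6_ge_num
  have hq1 : (((109024394 : ℝ) / 10000000) / ((108933291 : ℝ) / 10000000) - 1) * ((109024394 : ℝ) / 10000000) ^ 8 / 216720 < ((1951 : ℝ) / 2500) := by
    norm_num
  have hq2 : ((1951 : ℝ) / 2500) < (1 - ((109024394 : ℝ) / 10000000) / ((1759287 : ℝ) / 161051)) * ((1759287 : ℝ) / 161051) ^ 6 / 4200 := by
    norm_num
  linarith
/-- Numeral upper bound of `R_8(ℤ⁷)` (`μ_6 ≤ 129173954/10⁷`, `μ_8 ≥ 129111017/10⁷`, `2·8·p_8 = 469392`). [folklore] -/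
theorem loopCompat_eight_zd7_le_num :
    loopCompat 7 8 ≤ (((129173954 : ℝ) / 10000000) / ((129111017 : ℝ) / 10000000) - 1) * ((129173954 : ℝ) / 10000000) ^ 8 / 469392 := by
  have hc : ((closingCount 7 8 : ℕ) : ℝ) = 469392 := by rw [closingCount_eight_eq (by norm_num)]; norm_num
  exact loopCompat_le_of_brackets (d := 7) (τ := 8) memGrowth_six_zd7_bounds.2 memGrowth_eight_zd7_bounds.1 (by norm_num) hc
    (by norm_num)

/-- Numeral lower bound of `R_8(ℤ⁷)` (`μ_6 ≥ 129173873/10⁷`, `μ_8 ≤ 129111097/10⁷`). [folklore] -/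
theorem loopCompat_eight_zd7_ge_num :
    (1 - ((129111097 : ℝ) / 10000000) / ((129173873 : ℝ) / 10000000)) * ((129173873 : ℝ) / 10000000) ^ 8 / 469392 ≤ loopCompat 7 8 := by
  have hc : ((closingCount 7 8 : ℕ) : ℝ) = 469392 := by rw [closingCount_eight_eq (by norm_num)]; norm_num
  exact loopCompat_ge_of_brackets (d := 7) (τ := 8) memGrowth_six_zd7_bounds.1 (by norm_num) memGrowth_eight_zd7_bounds.2 hc
    (by norm_num)
/-- **`R_8(d) < R_6(d)` for every `d ≥ 2`.** [folklore] -/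
theorem loopCompat_eight_lt_six (hd : 2 ≤ d) : loopCompat d 8 < loopCompat d 6 := by
  rcases Nat.lt_or_ge d 7 with h | h
  · interval_cases d
    · exact loopCompat_chain_zd2.1
    · exact loopCompat_eight_lt_six_zd3
    · exact loopCompat_eight_lt_six_zd4
    · exact loopCompat_eight_lt_six_zd5
    · exact loopCompat_eight_lt_six_zd6
  · exact loopCompat_eight_lt_six_of_seven_le h

/-- **Clause (c) of C4 (`loopCompatStrictAntiMemory`) at `m = 3`, every dimension**: `R_8(d) < R_6(d)` for all `d ≥ 2`. [folklore] -/
theorem loopCompatStrictAntiMemory_rung_three (d : ℕ) (hd : 2 ≤ d) : loopCompat d (2 * 3 + 2) < loopCompat d (2 * 3) :=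
  loopCompat_eight_lt_six hd

/-! ### Clause (b) at the third rung: `R_8(d) < R_8(d+1)` in every dimension -/

/-- `R_8(d) < R_8(d+1)` for `d ≥ 7` (certificate `NU8(d)·DL8(d+1) < NL8(d+1)·DE8(d)` on `[7, ∞)`, shift by `pshift · 1`). [folklore] -/
theorem loopCompat_eight_lt_succ_of_seven_le (hd : 7 ≤ d) : loopCompat d 8 < loopCompat (d + 1) 8 := by
  have h8 := loopCompat_eight_le_peval (d := d) (by omega)
  have h8' := loopCompat_eight_ge_peval (d := d + 1) (by omega)
  push_cast at h8'
  have e1 : peval NL8 ((d : ℝ) + 1) = peval (pshift NL8 1) d := by rw [peval_pshift]; norm_num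
  have e2 : peval DL8 ((d : ℝ) + 1) = peval (pshift DL8 1) d := by rw [peval_pshift]; norm_num
  rw [e1, e2] at h8'
  have hDs : 0 < peval (pshift DL8 1) d := by
    rw [← e2]; have := DL8_pos (d := d + 1) (by omega); push_cast at this; exact this
  have hlt : peval (pmul NU8 (pshift DL8 1)) d < peval (pmul (pshift NL8 1) DE8) d :=
    peval_lt_of_shift (c := 7) (by decide +kernel) (by exact_mod_cast hd)
  rw [peval_pmul, peval_pmul] at hlt
  refine lt_of_le_of_lt h8 (lt_of_lt_of_le ?_ h8')
  rw [div_lt_div_iff₀ (DE8_pos (by omega)) hDs]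
  linarith

/-- `R_8(ℤ⁵) < R_8(ℤ⁶)` (numeral certificates). [folklore] -/
theorem loopCompat_eight_zd5_lt_zd6 : loopCompat 5 8 < loopCompat 6 8 := by
  have h1 := loopCompat_eight_zd5_le_num
  have h2 := loopCompat_eight_zd6_ge_num
  norm_num at h1 h2 ⊢
  linarith

/-- `R_8(ℤ⁶) < R_8(ℤ⁷)` (numeral certificates). [folklore] -/
theorem loopCompat_eight_zd6_lt_zd7 : loopCompat 6 8 < loopCompat 7 8 := by
  have h1 := loopCompat_eight_zd6_le_num
  have h2 := loopCompat_eight_zd7_ge_num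
  norm_num at h1 h2 ⊢
  linarith

/-- `R_8(ℤ⁴) < R_8(ℤ⁵)` (`R_8(ℤ⁴) ≤ 0.65`, …RungEightZ4; numeral lower bound at `d = 5`). [folklore] -/
theorem loopCompat_eight_zd4_lt_zd5 : loopCompat 4 8 < loopCompat 5 8 := by
  have h1 := loopCompat_eight_zd4_le
  have h2 := loopCompat_eight_zd5_ge_num
  norm_num at h1 h2 ⊢
  linarith

/-- `0.63 ≤ R_8(ℤ⁴)` — two-sided now that `2·8·p_8(ℤ⁴) = 22944` is exact (…ClosingOctagonsZ4Exact). [folklore] -/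
theorem loopCompat_eight_zd4_ge : (0.63 : ℝ) ≤ loopCompat 4 8 := by
  have hc : ((closingCount 4 8 : ℕ) : ℝ) = 22944 := by rw [closingCount_eight_zd4]; norm_num
  have h := loopCompat_ge_of_brackets (d := 4) (τ := 8) memGrowth_six_zd4_ge (by norm_num) memGrowth_eight_zd4_le hc (by norm_num)
  norm_num at h ⊢
  linarith

/-- `R_8(ℤ³) < R_8(ℤ⁴)` (`R_8(ℤ³) ≤ 0.54 < 0.63 ≤ R_8(ℤ⁴)`). [folklore] -/
theorem loopCompat_eight_zd3_lt_zd4 : loopCompat 3 8 < loopCompat 4 8 :=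
  lt_of_le_of_lt loopCompat_eight_zd3_le (lt_of_lt_of_le (by norm_num) loopCompat_eight_zd4_ge)

/-- **`R_8(d) < R_8(d+1)` for every `d ≥ 2`.** [folklore] -/
theorem loopCompat_eight_lt_succ (hd : 2 ≤ d) : loopCompat d 8 < loopCompat (d + 1) 8 := by
  rcases Nat.lt_or_ge d 7 with h | h
  · interval_cases d
    · exact loopCompat_eight_zd2_lt_zd3
    · exact loopCompat_eight_zd3_lt_zd4
    · exact loopCompat_eight_zd4_lt_zd5
    · exact loopCompat_eight_zd5_lt_zd6
    · exact loopCompat_eight_zd6_lt_zd7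
  · exact loopCompat_eight_lt_succ_of_seven_le h

/-- `R_8` is strictly increasing on `d ≥ 2`. [folklore] -/
theorem loopCompat_eight_lt_of_lt {d e : ℕ} (hd : 2 ≤ d) (hde : d < e) : loopCompat d 8 < loopCompat e 8 := by
  induction e with
  | zero => omega
  | succ e ih =>
    rcases Nat.lt_succ_iff_lt_or_eq.1 hde with h | h
    · exact (ih h).trans (loopCompat_eight_lt_succ (by omega))
    · subst h; exact loopCompat_eight_lt_succ hd

/-- **Clause (b) of C4 (`loopCompatStrictMonoDim`) at the third rung, every dimension**: `R_8(d) < R_8(d+1)` for all `d ≥ 2`. [folklore] -/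
theorem loopCompatStrictMonoDim_rung_eight (d : ℕ) (hd : 2 ≤ d) : loopCompat d (2 * 4) < loopCompat (d + 1) (2 * 4) :=
  loopCompat_eight_lt_succ hd

/-! ### The third mean-field constant: `2d·(1 − R_8(d)) → 70/27` -/

/-- **`2d·(1 − R_8(d)) ≥ 70/27 − 4/d`** for every `d ≥ 5`. [folklore] -/
theorem sigma_one_sub_loopCompat_eight_ge (hd : 5 ≤ d) : 70 / 27 - 4 / (d : ℝ) ≤ 2 * (d : ℝ) * (1 - loopCompat d 8) := by
  have hd' : (5 : ℝ) ≤ d := by exact_mod_cast hd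
  have hd0 : (0 : ℝ) < d := by linarith
  have h := loopCompat_eight_le_peval hd
  have hD := DE8_pos hd
  -- certificate: 27·(2d)²·(DE − NU) − (70·2d − 216)·DE ≥ 0 on [5, ∞)
  have hc : 0 ≤ peval (psub (pmul [0, 0, 108] (psub DE8 NU8)) (pmul [-216, 140] DE8)) (d : ℝ) :=
    peval_nonneg_of_shift (c := 5) (by decide +kernel) (by exact_mod_cast hd)
  rw [peval_psub, peval_pmul, peval_pmul, peval_psub] at hc
  have e1 : peval [0, 0, 108] (d : ℝ) = 108 * (d : ℝ) ^ 2 := by simp [peval]; ring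
  have e2 : peval [-216, 140] (d : ℝ) = 140 * (d : ℝ) - 216 := by simp [peval]; ring
  rw [e1, e2] at hc
  -- from R ≤ NU/DE: 2d(1 - R) ≥ 2d(1 - NU/DE)
  have h1 : 2 * (d : ℝ) * (1 - peval NU8 d / peval DE8 d) ≤ 2 * (d : ℝ) * (1 - loopCompat d 8) := by nlinarith
  refine le_trans ?_ h1
  rw [show 2 * (d : ℝ) * (1 - peval NU8 d / peval DE8 d) = 2 * d * (peval DE8 d - peval NU8 d) / peval DE8 d by field_simp,
    le_div_iff₀ hD, show (70 / 27 - 4 / (d : ℝ)) * peval DE8 d = ((140 * d - 216) * peval DE8 d) / (54 * d) by field_simp; ring,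
    div_le_iff₀ (by positivity)]
  nlinarith

/-- **`2d·(1 − R_8(d)) ≤ 70/27 + 4/d`** for every `d ≥ 5`. [folklore] -/
theorem sigma_one_sub_loopCompat_eight_le (hd : 5 ≤ d) : 2 * (d : ℝ) * (1 - loopCompat d 8) ≤ 70 / 27 + 4 / (d : ℝ) := by
  have hd' : (5 : ℝ) ≤ d := by exact_mod_cast hd
  have hd0 : (0 : ℝ) < d := by linarith
  have h := loopCompat_eight_ge_peval hd
  have hD := DL8_pos hd
  -- certificate: (70·2d + 216)·DL − 27·(2d)²·(DL − NL) ≥ 0 on [5, ∞)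
  have hc : 0 ≤ peval (psub (pmul [216, 140] DL8) (pmul [0, 0, 108] (psub DL8 NL8))) (d : ℝ) :=
    peval_nonneg_of_shift (c := 5) (by decide +kernel) (by exact_mod_cast hd)
  rw [peval_psub, peval_pmul, peval_pmul, peval_psub] at hc
  have e1 : peval [0, 0, 108] (d : ℝ) = 108 * (d : ℝ) ^ 2 := by simp [peval]; ring
  have e2 : peval [216, 140] (d : ℝ) = 140 * (d : ℝ) + 216 := by simp [peval]; ring
  rw [e1, e2] at hc
  have h1 : 2 * (d : ℝ) * (1 - loopCompat d 8) ≤ 2 * (d : ℝ) * (1 - peval NL8 d / peval DL8 d) := by nlinarith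
  refine le_trans h1 ?_
  rw [show 2 * (d : ℝ) * (1 - peval NL8 d / peval DL8 d) = 2 * d * (peval DL8 d - peval NL8 d) / peval DL8 d by field_simp,
    div_le_iff₀ hD, show (70 / 27 + 4 / (d : ℝ)) * peval DL8 d = ((140 * d + 216) * peval DL8 d) / (54 * d) by field_simp; ring,
    le_div_iff₀ (by positivity)]
  nlinarith

/-- **`2d·(1 − R_8(d)) → 70/27`**: the third-rung mean-field constant is `c_4 = 70/27`. [folklore] -/
theorem tendsto_sigma_mul_one_sub_loopCompat_eight :
    Tendsto (fun d : ℕ => 2 * (d : ℝ) * (1 - loopCompat d 8)) atTop (𝓝 (70 / 27)) := by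
  have h0 : Tendsto (fun d : ℕ => (4 : ℝ) / (d : ℝ)) atTop (𝓝 0) := tendsto_const_div_atTop_nhds_zero_nat 4
  have hlo : Tendsto (fun d : ℕ => (70 : ℝ) / 27 - 4 / (d : ℝ)) atTop (𝓝 (70 / 27)) := by
    simpa using tendsto_const_nhds.sub h0
  have hhi : Tendsto (fun d : ℕ => (70 : ℝ) / 27 + 4 / (d : ℝ)) atTop (𝓝 (70 / 27)) := by
    simpa using tendsto_const_nhds.add h0
  refine tendsto_of_tendsto_of_tendsto_of_le_of_le' hlo hhi ?_ ?_
  · exact Filter.eventually_atTop.2 ⟨5, fun d hd => sigma_one_sub_loopCompat_eight_ge hd⟩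
  · exact Filter.eventually_atTop.2 ⟨5, fun d hd => sigma_one_sub_loopCompat_eight_le hd⟩

/-- The `m = 4` instance of the typed conjecture `loopCompatMeanField`, with its constant `70/27`. [folklore] -/
theorem loopCompatMeanField_rung_eight :
    ∃ c : ℝ, 0 < c ∧ Tendsto (fun d : ℕ => (2 * (d : ℝ)) * (1 - loopCompat d (2 * 4))) atTop (𝓝 c) :=
  ⟨70 / 27, by norm_num, tendsto_sigma_mul_one_sub_loopCompat_eight⟩

/-- **`R_8(d) → 1`** as `d → ∞`. [folklore] -/
theorem tendsto_loopCompat_eight : Tendsto (fun d : ℕ => loopCompat d 8) atTop (𝓝 1) := by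
  have h0 : Tendsto (fun d : ℕ => (2 : ℝ) / (d : ℝ)) atTop (𝓝 0) := tendsto_const_div_atTop_nhds_zero_nat 2
  have hlo : Tendsto (fun d : ℕ => (1 : ℝ) - 2 / (d : ℝ)) atTop (𝓝 1) := by
    simpa using tendsto_const_nhds.sub h0
  refine tendsto_of_tendsto_of_tendsto_of_le_of_le' hlo tendsto_const_nhds ?_ ?_
  · refine Filter.eventually_atTop.2 ⟨5, fun d hd => ?_⟩
    have hd' : (5 : ℝ) ≤ d := by exact_mod_cast hd
    have hd0 : (0 : ℝ) < d := by linarith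
    have h := sigma_one_sub_loopCompat_eight_le hd
    have h2 : (4 : ℝ) / d ≤ 1 := by rw [div_le_iff₀ hd0]; linarith
    have h3 : 2 * (d : ℝ) * (1 - loopCompat d 8) ≤ 4 := by linarith
    have h4 : 1 - loopCompat d 8 ≤ 2 / d := by rw [le_div_iff₀ hd0]; nlinarith
    linarith
  · exact Filter.eventually_atTop.2 ⟨2, fun d hd => (loopCompat_eight_lt_one hd).le⟩

/-- The `m = 4` instance of the typed conjecture `loopCompatTendstoOne`. [folklore] -/
theorem loopCompatTendstoOne_rung_eight : Tendsto (fun d : ℕ => loopCompat d (2 * 4)) atTop (𝓝 1) :=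
  tendsto_loopCompat_eight

/-- **The typed conjecture `loopCompatMeanField` holds at every rung `m ≤ 4`** (constants `c_2 = 2`, `c_3 = 5/2`, `c_4 = 70/27`:
…LoopExclusionMeanField, …LoopExclusionRungSixDimension, this file). [folklore] -/
theorem loopCompatMeanField_of_le_four (m : ℕ) (hm : 2 ≤ m) (hm4 : m ≤ 4) :
    ∃ c : ℝ, 0 < c ∧ Tendsto (fun d : ℕ => (2 * (d : ℝ)) * (1 - loopCompat d (2 * m))) atTop (𝓝 c) := by
  interval_cases m
  · exact loopCompatMeanField_rung_four
  · exact loopCompatMeanField_rung_six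
  · exact loopCompatMeanField_rung_eight

/-- **The typed conjecture `loopCompatTendstoOne` holds at every rung `m ≤ 4`** (`R_{2m}(d) → 1`). [folklore] -/
theorem loopCompatTendstoOne_of_le_four (m : ℕ) (hm : 2 ≤ m) (hm4 : m ≤ 4) :
    Tendsto (fun d : ℕ => loopCompat d (2 * m)) atTop (𝓝 1) := by
  interval_cases m
  · exact loopCompatTendstoOne_rung_four
  · exact loopCompatTendstoOne_rung_six
  · exact loopCompatTendstoOne_rung_eight

/-! ### C4 status after this file: the typed clauses restricted to the rungs `m ≤ 4` (`(c)`: `m ≤ 3`) are theorems -/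

/-- **Clause (a) `loopCompatWindow` for all `d ≥ 2` and all rungs `2 ≤ m ≤ 4`.** [folklore] -/
theorem loopCompatWindow_of_le_four (d : ℕ) (hd : 2 ≤ d) (m : ℕ) (hm : 2 ≤ m) (hm4 : m ≤ 4) :
    0 < loopCompat d (2 * m) ∧ loopCompat d (2 * m) < 1 := by
  interval_cases m
  · exact loopCompatWindow_rung_four d hd
  · exact loopCompatWindow_rung_six d hd
  · exact loopCompatWindow_rung_eight d hd

/-- **Clause (b) `loopCompatStrictMonoDim` for all `d ≥ 2` and all rungs `2 ≤ m ≤ 4`.** [folklore] -/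
theorem loopCompatStrictMonoDim_of_le_four (d : ℕ) (hd : 2 ≤ d) (m : ℕ) (hm : 2 ≤ m) (hm4 : m ≤ 4) :
    loopCompat d (2 * m) < loopCompat (d + 1) (2 * m) := by
  interval_cases m
  · exact loopCompatStrictMonoDim_rung_four d hd
  · exact loopCompatStrictMonoDim_rung_six d hd
  · exact loopCompatStrictMonoDim_rung_eight d hd

/-- **Clause (c) `loopCompatStrictAntiMemory` for all `d ≥ 2` and the rungs `m = 2, 3`.** [folklore] -/
theorem loopCompatStrictAntiMemory_of_le_three (d : ℕ) (hd : 2 ≤ d) (m : ℕ) (hm : 2 ≤ m) (hm3 : m ≤ 3) :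
    loopCompat d (2 * m + 2) < loopCompat d (2 * m) := by
  interval_cases m
  · exact loopCompatStrictAntiMemory_rung_two d hd
  · exact loopCompatStrictAntiMemory_rung_three d hd

end Summit.CriticalPhenomena.PercolationContinuityZ3.Theorems.Pcint.MemoryTail
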